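import Literature.MathematicalPhysics.QuantumFieldTheory.Balaban1983to89.B8Ineq159FlatCubeMemberPerCubeGamma
import Literature.MathematicalPhysics.QuantumFieldTheory.Balaban1983to89.B8Ineq159FlatCubeMemberPrinted
import Literature.MathematicalPhysics.QuantumFieldTheory.Balaban1983to89.B8Ineq159FlatMaps
import Literature.MathematicalPhysics.QuantumFieldTheory.Balaban1983to89.B9SupplySockB9P3ZdGamma
import Literature.MathematicalPhysics.QuantumFieldTheory.Balaban1983to89.B8Eq191FlatLettersCubeMember

/-!
# `Balaban1983to89.B8Ineq159FlatCubeMemberSCGamma` — [Balaban1985RegularSpaces] (1.59) AT `U₀ = 1` ON THE CUBE MEMBER: THE POINTWISE BODY OVER PRINT'S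
# CLASS ⟹ THE SCALAR FOUR-LINE CLAUSE IN THE FLAT LINE'S γ CURRENCY (per cube), its UNIFORM form from the named fact and its PER-CUBE inhabitant

statement-level skeleton of published theorems with citation tags; proofs where landed; nothing here is a claim about the
Yang–Mills mass gap

PDF held: `paper:balaban1985-cmp99-regular-spaces-gauge-fixing`; (1.55)–(1.62) pp. 86–87, (1.31) p. 82, (1.131) p. 99, p. 98, p. 77 — re-read at typing.
[4] = `[Balaban1985BackgroundPropagators]` Thm 3.3 p. 399; [B6] = `[Balaban1984PropagatorsII]` (2.3) p. 224, Prop. 2.6 p. 247.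

CITATION HEADER (lean-in-tree rule).  Cell `pub-ymgap` (HUMAN RULING D-0062, Track A), DAG node N05 = [B8], seat `pub-ymgap-dag-n05-e` g10 (R141 (C) row s3b —
the FLAT line of Proposition 6's cube road, edition γ; file Fγ10a).  WHY THIS FILE.  The flat line (this seat g4–g10) reduces Proposition 6 at a cube member
to SCALAR flat (1.59) clauses in `msup`∕`wsup` form: «`|φ|₍₋₁₎, |∇φ|₍₋₂₎, |∂*∂φ|₍₋₃₎, |Δφ|₍₋₃₎ ≤ B₀(|J(φ)|₍₋₃₎ + |B₁|(φ)) + B_∂Φ₀(φ)`» for ℂ-valued bond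
functions `φ` in the flat Landau gauge on the collars of `{□_j}`, averaging index `Λb m j ∪ {level-0 crossing bonds of □₀}` (the β∕γ socket shape).
dag-n05-c's named fact `B8Ineq159FlatCubeMemberPrinted.Ineq159FlatCubeMemberPrinted d L` (p573921) states (1.59) at `U₀ = 1` in PRINT's POINTWISE form (1.62)
over print's class `cubeLamBP` (three members, one majorant `N`), and dag-n05-w3's `B8Ineq159FlatCubeMemberPerCube.exists_B0_ineq159Flat_perCube` (p585691)
PROVES that pointwise body at every fixed cube datum with SOME `B₀` (no thresholds).  THIS FILE is the adapter both consume (dag-n05-w3 ASK-Fγ10, bus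
2026-08-27 23:36Z): §1 ★★ `sc4_of_pointwise159` — at ONE cube datum `(η, a, M, ρ, k, m)`, the pointwise body (VERBATIM the matrix of the named fact) implies
the scalar FOUR-LINE clause for every index predicate `I ⊇ cubeLamBP … m` with `B_∂ := B₀ ≥ 1` (`Jcur = pdiv ∘ plaqCovDeriv` is `rfl`, so the `|∂*∂φ|` line is
the `|J|` member; the real suprema are attained because `φ` is finitely supported — `sideTouches_pairs_finite`); §2 ★ `sc4_cubeMember_of_ineq159Printed` — the
UNIFORM clause at every cube datum of print's p. 98 big-block sub-lattice from the named fact (index = n05-c's `cubeLamBP`), and ★ `sc4_cubeMember_split_of_ineq159Printed`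
— the same in the flat line's split index `cubeLamBP' ∪ CrossB` via dag-n05-w3's level-0 dictionary `mem_cubeLamBP_zero_iff_cubeLamBP'_or_crossB`
(p588005, consumed BY NAME); §3 ★ `sc4_cubeMember_inhabited` ∕ `…_split_inhabited` — the PER-CUBE inhabitant (A6 witness of the flat line's hypotheses at every cube,
`B₀` depending on the cube).  Kind «kernel-checked proof», theorems only, no `def`.

HONEST SCOPE ∕ A6.  §1 and §3 are unconditional; §2 takes the named fact `Ineq159FlatCubeMemberPrinted d L` ([4] Thm 3.3 at `U = 1`, Dirichlet cube, print's
class — OPEN in the tree; lit-balaban ME #33 → dag-n05-c transplant) as a HYPOTHESIS.  What §3 certifies: the flat line's SCγ clauses are INHABITED at every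
cube (no vacuity in edition γ — contrast p572834 for edition β); what it does NOT give: a `B₀` uniform in the cube, which Proposition 6 needs (threshold and
constant) — that is exactly the named fact.  `B_∂ = B₀` costs the consumer the window `4B₀ ≤ (dL − 1)B₀`, i.e. `5 ≤ d·L` (print: `d = 4`).  Count-neutral; N05
NOT discharged; one finite `𝕋⁴` programme at fixed `ε`, Bałaban as printed; nothing continuum ∕ ℝ⁴ ∕ OS ∕ mass-gap ∕ Clay.  No `sorry`, no `def`, no
`instance`, no `notation`.  Unit `pub-ymgap-dag-n05-e` (g10), 2026-08-28.
-/

noncomputable section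

namespace Literature.MathematicalPhysics.QuantumFieldTheory.Balaban1983to89.B8Ineq159FlatCubeMemberSCGamma

open B7Prop1Explicit B7Prop2Explicit B7Prop1Local
open B7Prop4GeneralLevels (linCovIter)
open B8Ineq132 (covDerivFwd BondTouches)
open B8Eq140Level (SideTouches sideTouches_mono sideTouches_of_bondTouches)
open B8Eq143PlaqExpansion (pdiv)
open B8Eq146AExpansion (iEta plaqCovDeriv)
open B8Eq155JBound (Jcur wsup wsup_le le_wsup wsup_nonneg)
open B8ScaledSupNorm (weight msup Bdd bondNorm msup_le msup_nonneg weight_mul_norm_le_msup weight_neg_natCast weight_nonneg)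
open B8Eq138LandauZd (IsLandau138 covLap)
open B8Eq131CubesAdmissible (cubeFam)
open B8CubeMemberZd (cubeLamS cubeLamB)
open B8Ineq159FlatCubeMemberPrinted (cubeLamBP Ineq159FlatCubeMemberPrinted)
open B8Ineq159FlatCubeMemberPerCube (sideTouches_pairs_finite exists_B0_ineq159Flat_perCube)
open B8Ineq159FlatCubeMemberPerCubeGamma (mem_cubeLamBP_zero_iff_cubeLamBP'_or_crossB)
open B9SupplySockB9P3ZdBeta (CrossB)
open B9SupplySockB9P3ZdGamma (cubeLamBP' cubeLamBP'_of_ne_zero)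
open B8Ineq159FlatMaps (norm_Jcur_flat_le)
open B9Eq316TowerFlatIsOneStep (linCovIter_one_left)
open B7Prop4Flat (norm_linQIter_le)
open B8Eq191FlatLettersCubeMember (cubeFam_subset_zero)

export B7Prop1Explicit (Site)

variable {d : ℕ}

/-! ## §1 The pointwise body at one cube datum ⟹ the scalar four-line clause, any index `⊇ cubeLamBP`, `B_∂ := B₀` -/

/-- ★★ **(1.59) AT `U₀ = 1` ON THE CUBE MEMBER, ONE DATUM: PRINT's POINTWISE FORM ⟹ THE FLAT LINE's SCALAR FOUR-LINE CLAUSE.**  At a fixed cube datum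
`(η, a, M, ρ, k)` and truncation `m ≤ k` (`L ≤ ρ`), suppose the POINTWISE BODY of dag-n05-c's named fact holds with the constant `B₀ ≥ 1`: for every
ℂ-valued `φ` in the flat Landau gauge on the collars with the support clause, and every majorant `N ≥ 0` of (i) `(Lʲη)³|J(φ)|` on the bonds of `□_j`, (ii)
`|Q_j(iηφ)(c)|` on print's class `cubeLamBP … m j`, (iii) `η|φ|` off the bonds of `□₀`, the three members `(Lʲη)|φ|`, `(Lʲη)²|∇φ|`, `(Lʲη)³|Δφ|` are `≤ B₀N`
on the sides touching `□_j` ((1.62) p. 87).  Then for every index predicate `I` containing print's class (`cubeLamBP … m j ⊆ I j`) and every such `φ`, the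
FOUR-LINE clause holds in the tree's norms: `|φ|₍₋₁₎, |∇φ|₍₋₂₎, |∂*∂φ|₍₋₃₎, |Δφ|₍₋₃₎ ≤ B₀(|J(φ)|₍₋₃₎ + wsup_I|Q(iηφ)|) + B₀·Φ₀(φ)` (`Φ₀` = the exterior-collar
term on the sides touching `□₀` that are not bonds of `□₀`).  PROOF: `φ` is finitely supported (`sideTouches_pairs_finite`), so the three right-hand suprema
are attained (`Bdd`, `le_wsup`); take `N := |J|₍₋₃₎ + wsup + Φ₀` and read the body through `msup_le`; the `|∂*∂φ|` line is the `|J|` member itself (`Jcur =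
pdiv ∘ plaqCovDeriv`, `rfl`) and uses `B₀ ≥ 1`.
[cite: Balaban1985RegularSpaces, (1.59) p.86, (1.62) p.87, (1.55) p.86, (1.31) p.82, (1.131) p.99, p.77; Balaban1985BackgroundPropagators, Thm 3.3 p.399; Balaban1984PropagatorsII, (2.3) p.224] -/
theorem sc4_of_pointwise159 (hd2 : 2 ≤ d) {L : ℕ} (hL : 1 ≤ L) {η : ℝ} (hη : 0 < η) (a : Site d) (M : ℕ) {ρ : ℕ} (hρ : L ≤ ρ)
    {k m : ℕ} (hmk : m ≤ k) {B₀ : ℝ} (hB₀ : 1 ≤ B₀)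
    (I : ℕ → Site d × Fin d → Prop) (hI : ∀ j, j ≤ m → ∀ c ∈ cubeLamBP L a M ρ k m j, I j c)
    (hbody : ∀ φ : Site d → Fin d → ℂ,
      IsLandau138 L m η (cubeFam false L a M ρ k 0) (cubeLamS L a M ρ k m) (1 : Site d → Fin d → ℂˣ) φ →
      (∀ (y : Site d) (τ : Fin d), (∀ j, j ≤ m → ¬ SideTouches (cubeFam false L a M ρ k j) y τ) → φ y τ = 0) →
      ∀ N : ℝ, 0 ≤ N →
        (∀ j, j ≤ m → ∀ (y : Site d) (τ : Fin d), BondTouches (cubeFam false L a M ρ k j) y τ →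
            ((L : ℝ) ^ j * η) ^ 3 * ‖Jcur η (1 : Site d → Fin d → ℂˣ) φ τ y‖ ≤ N) →
        (∀ j, j ≤ m → ∀ c ∈ cubeLamBP L a M ρ k m j,
            ‖linCovIter L (1 : Site d → Fin d → ℂˣ) (iEta η φ) j c.1 c.2‖ ≤ N) →
        (∀ (y : Site d) (τ : Fin d), ¬ BondTouches (cubeFam false L a M ρ k 0) y τ → η * ‖φ y τ‖ ≤ N) →
        ∀ j, j ≤ m → ∀ (y : Site d) (τ : Fin d), SideTouches (cubeFam false L a M ρ k j) y τ →
          ((L : ℝ) ^ j * η) * ‖φ y τ‖ ≤ B₀ * N ∧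
          (∀ ν : Fin d, ((L : ℝ) ^ j * η) ^ 2 *
            ‖covDerivFwd η (1 : Site d → Fin d → ℂˣ) ν (fun z => φ z τ) y‖ ≤ B₀ * N) ∧
          ((L : ℝ) ^ j * η) ^ 3 * ‖covLap η (1 : Site d → Fin d → ℂˣ) (fun z => φ z τ) y‖ ≤ B₀ * N)
    (φ : Site d → Fin d → ℂ)
    (hLan : IsLandau138 L m η (cubeFam false L a M ρ k 0) (cubeLamS L a M ρ k m) (1 : Site d → Fin d → ℂˣ) φ)
    (hsupp : ∀ (y : Site d) (τ : Fin d), (∀ j, j ≤ m → ¬ SideTouches (cubeFam false L a M ρ k j) y τ) → φ y τ = 0) :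
    msup L m η (-(1 : ℝ)) (fun j (b : Site d × Fin d) => SideTouches (cubeFam false L a M ρ k j) b.1 b.2) (fun b => φ b.1 b.2)
        ≤ B₀ * (bondNorm L m η (-(3 : ℝ)) (cubeFam false L a M ρ k) (fun x μ => Jcur η (1 : Site d → Fin d → ℂˣ) φ μ x)
          + wsup 1 (fun p : {p : ℕ × (Site d × Fin d) // p.1 ≤ m ∧ I p.1 p.2} =>
              linCovIter L (1 : Site d → Fin d → ℂˣ) (iEta η φ) p.1.1 p.1.2.1 p.1.2.2))
          + B₀ * msup L m η (-(1 : ℝ)) (fun j (b : Site d × Fin d) => j = 0 ∧ SideTouches (cubeFam false L a M ρ k 0) b.1 b.2 ∧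
              ¬ BondTouches (cubeFam false L a M ρ k 0) b.1 b.2) (fun b => φ b.1 b.2) ∧
      msup L m η (-(2 : ℝ)) (fun j (t : Fin d × Fin d × Site d) => SideTouches (cubeFam false L a M ρ k j) t.2.2 t.2.1)
          (fun t => covDerivFwd η (1 : Site d → Fin d → ℂˣ) t.1 (fun z => φ z t.2.1) t.2.2)
        ≤ B₀ * (bondNorm L m η (-(3 : ℝ)) (cubeFam false L a M ρ k) (fun x μ => Jcur η (1 : Site d → Fin d → ℂˣ) φ μ x)
          + wsup 1 (fun p : {p : ℕ × (Site d × Fin d) // p.1 ≤ m ∧ I p.1 p.2} =>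
              linCovIter L (1 : Site d → Fin d → ℂˣ) (iEta η φ) p.1.1 p.1.2.1 p.1.2.2))
          + B₀ * msup L m η (-(1 : ℝ)) (fun j (b : Site d × Fin d) => j = 0 ∧ SideTouches (cubeFam false L a M ρ k 0) b.1 b.2 ∧
              ¬ BondTouches (cubeFam false L a M ρ k 0) b.1 b.2) (fun b => φ b.1 b.2) ∧
      bondNorm L m η (-(3 : ℝ)) (cubeFam false L a M ρ k)
          (fun x μ => pdiv η (1 : Site d → Fin d → ℂˣ) (plaqCovDeriv η (1 : Site d → Fin d → ℂˣ) φ) μ x)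
        ≤ B₀ * (bondNorm L m η (-(3 : ℝ)) (cubeFam false L a M ρ k) (fun x μ => Jcur η (1 : Site d → Fin d → ℂˣ) φ μ x)
          + wsup 1 (fun p : {p : ℕ × (Site d × Fin d) // p.1 ≤ m ∧ I p.1 p.2} =>
              linCovIter L (1 : Site d → Fin d → ℂˣ) (iEta η φ) p.1.1 p.1.2.1 p.1.2.2))
          + B₀ * msup L m η (-(1 : ℝ)) (fun j (b : Site d × Fin d) => j = 0 ∧ SideTouches (cubeFam false L a M ρ k 0) b.1 b.2 ∧
              ¬ BondTouches (cubeFam false L a M ρ k 0) b.1 b.2) (fun b => φ b.1 b.2) ∧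
      bondNorm L m η (-(3 : ℝ)) (cubeFam false L a M ρ k) (fun x μ => covLap η (1 : Site d → Fin d → ℂˣ) (fun z => φ z μ) x)
        ≤ B₀ * (bondNorm L m η (-(3 : ℝ)) (cubeFam false L a M ρ k) (fun x μ => Jcur η (1 : Site d → Fin d → ℂˣ) φ μ x)
          + wsup 1 (fun p : {p : ℕ × (Site d × Fin d) // p.1 ≤ m ∧ I p.1 p.2} =>
              linCovIter L (1 : Site d → Fin d → ℂˣ) (iEta η φ) p.1.1 p.1.2.1 p.1.2.2))
          + B₀ * msup L m η (-(1 : ℝ)) (fun j (b : Site d × Fin d) => j = 0 ∧ SideTouches (cubeFam false L a M ρ k 0) b.1 b.2 ∧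
              ¬ BondTouches (cubeFam false L a M ρ k 0) b.1 b.2) (fun b => φ b.1 b.2) := by
  -- abbreviations for the three right-hand members
  obtain ⟨X, hX⟩ : ∃ X : ℝ, X = bondNorm L m η (-(3 : ℝ)) (cubeFam false L a M ρ k) (fun x μ => Jcur η (1 : Site d → Fin d → ℂˣ) φ μ x) :=
    ⟨_, rfl⟩
  obtain ⟨Y, hY⟩ : ∃ Y : ℝ, Y = wsup 1 (fun p : {p : ℕ × (Site d × Fin d) // p.1 ≤ m ∧ I p.1 p.2} =>
      linCovIter L (1 : Site d → Fin d → ℂˣ) (iEta η φ) p.1.1 p.1.2.1 p.1.2.2) := ⟨_, rfl⟩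
  obtain ⟨Z, hZ⟩ : ∃ Z : ℝ, Z = msup L m η (-(1 : ℝ)) (fun j (b : Site d × Fin d) => j = 0 ∧ SideTouches (cubeFam false L a M ρ k 0) b.1 b.2 ∧
      ¬ BondTouches (cubeFam false L a M ρ k 0) b.1 b.2) (fun b => φ b.1 b.2) := ⟨_, rfl⟩
  have hJX : bondNorm L m η (-(3 : ℝ)) (cubeFam false L a M ρ k)
      (fun x μ => pdiv η (1 : Site d → Fin d → ℂˣ) (plaqCovDeriv η (1 : Site d → Fin d → ℂˣ) φ) μ x) = X := by rw [hX]; rfl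
  rw [hJX, ← hX, ← hY, ← hZ]
  have hL1 : (1 : ℝ) ≤ L := by exact_mod_cast hL
  have hX0 : 0 ≤ X := by rw [hX]; exact msup_nonneg L m hη.le _ _ _
  have hY0 : 0 ≤ Y := by rw [hY]; exact wsup_nonneg zero_le_one _
  have hZ0 : 0 ≤ Z := by rw [hZ]; exact msup_nonneg L m hη.le _ _ _
  have hB₀0 : 0 ≤ B₀ := zero_le_one.trans hB₀
  -- weights
  have hw3 : ∀ j : ℕ, weight L η (-(3 : ℝ)) j = ((L : ℝ) ^ j * η) ^ 3 := fun j => by simpa using weight_neg_natCast L η 3 j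
  have hw2 : ∀ j : ℕ, weight L η (-(2 : ℝ)) j = ((L : ℝ) ^ j * η) ^ 2 := fun j => by simpa using weight_neg_natCast L η 2 j
  have hw1 : ∀ j : ℕ, weight L η (-(1 : ℝ)) j = (L : ℝ) ^ j * η := fun j => by simpa using weight_neg_natCast L η 1 j
  have hscale : ∀ j, j ≤ m → (L : ℝ) ^ j * η ≤ (L : ℝ) ^ m * η := fun j hj =>
    mul_le_mul_of_nonneg_right (pow_le_pow_right₀ hL1 hj) hη.le
  have hscale0 : ∀ j : ℕ, 0 ≤ (L : ℝ) ^ j * η := fun j => by positivity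
  -- Step 1: `φ` is finitely supported, hence uniformly bounded
  obtain ⟨C, hC0, hC⟩ : ∃ C : ℝ, 0 ≤ C ∧ ∀ (y : Site d) (τ : Fin d), ‖φ y τ‖ ≤ C := by
    have hfin := sideTouches_pairs_finite L a M ρ hmk (k := k) (m := m)
    obtain ⟨C, hC⟩ := (hfin.image fun q : ℕ × (Site d × Fin d) => ‖φ q.2.1 q.2.2‖).bddAbove
    refine ⟨max C 0, le_max_right _ _, fun y τ => ?_⟩
    by_cases h : ∃ j, j ≤ m ∧ SideTouches (cubeFam false L a M ρ k j) y τ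
    · obtain ⟨j, hj, hs⟩ := h
      have hmem : ‖φ y τ‖ ∈ (fun q : ℕ × (Site d × Fin d) => ‖φ q.2.1 q.2.2‖) ''
          {q : ℕ × (Site d × Fin d) | q.1 ≤ m ∧ SideTouches (cubeFam false L a M ρ k q.1) q.2.1 q.2.2} :=
        ⟨(j, (y, τ)), ⟨hj, hs⟩, rfl⟩
      exact (hC hmem).trans (le_max_left _ _)
    · simp only [not_exists, not_and] at h
      rw [hsupp y τ fun j hj hs => h j hj hs, norm_zero]
      exact le_max_right _ _
  -- Step 2: the `Bdd` side conditions of the three right-hand families, and the member-below-sup facts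
  obtain ⟨J₀, hJ₀⟩ : ∃ J₀ : ℝ, J₀ =
      (d : ℝ) * (η⁻¹ * ((η⁻¹ * (C + C) + η⁻¹ * (C + C)) + (η⁻¹ * (C + C) + η⁻¹ * (C + C)))) +
      (d : ℝ) * (η⁻¹ * ((η⁻¹ * (C + C) + η⁻¹ * (C + C)) + (η⁻¹ * (C + C) + η⁻¹ * (C + C)))) := ⟨_, rfl⟩
  have hJ₀0 : 0 ≤ J₀ := by rw [hJ₀]; positivity
  have hJbd : ∀ (μ : Fin d) (x : Site d), ‖Jcur η (1 : Site d → Fin d → ℂˣ) φ μ x‖ ≤ J₀ := fun μ x => by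
    rw [hJ₀]; exact norm_Jcur_flat_le hη hC0 hC μ x
  have hBddJ : Bdd L m η (-(3 : ℝ)) (fun j (b : Site d × Fin d) => BondTouches (cubeFam false L a M ρ k j) b.1 b.2)
      (fun b => Jcur η (1 : Site d → Fin d → ℂˣ) φ b.2 b.1) := by
    refine ⟨((L : ℝ) ^ m * η) ^ 3 * J₀, fun j hj b _ => ?_⟩
    rw [hw3]
    exact mul_le_mul (pow_le_pow_left₀ (hscale0 j) (hscale j hj) 3) (hJbd _ _) (norm_nonneg _) (by positivity)
  have hiEta : ∀ (y : Site d) (κ : Fin d), ‖iEta η φ y κ‖ ≤ η * C := fun y κ => B8Eq146AExpansion.norm_iEta_le hη.le hC y κ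
  have hηC : 0 ≤ η * C := by positivity
  have hQbd : ∀ p : {p : ℕ × (Site d × Fin d) // p.1 ≤ m ∧ I p.1 p.2},
      1 * ‖linCovIter L (1 : Site d → Fin d → ℂˣ) (iEta η φ) p.1.1 p.1.2.1 p.1.2.2‖ ≤ (L : ℝ) ^ m * (η * C) := by
    intro p
    rw [one_mul, linCovIter_one_left L hL _ hηC hiEta p.1.1]
    exact (norm_linQIter_le L hL _ hηC hiEta p.1.1 p.1.2.1 p.1.2.2).trans
      (mul_le_mul_of_nonneg_right (pow_le_pow_right₀ hL1 p.2.1) hηC)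
  have hBddZ : Bdd L m η (-(1 : ℝ)) (fun j (b : Site d × Fin d) => j = 0 ∧ SideTouches (cubeFam false L a M ρ k 0) b.1 b.2 ∧
      ¬ BondTouches (cubeFam false L a M ρ k 0) b.1 b.2) (fun b => φ b.1 b.2) := by
    refine ⟨((L : ℝ) ^ m * η) * C, fun j hj b _ => ?_⟩
    rw [hw1]
    exact mul_le_mul (hscale j hj) (hC _ _) (norm_nonneg _) (by positivity)
  -- (i): every weighted `J` member is below `X`
  have hi : ∀ j, j ≤ m → ∀ (y : Site d) (τ : Fin d), BondTouches (cubeFam false L a M ρ k j) y τ →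
      ((L : ℝ) ^ j * η) ^ 3 * ‖Jcur η (1 : Site d → Fin d → ℂˣ) φ τ y‖ ≤ X + Y + Z := by
    intro j hj y τ hb
    have h := weight_mul_norm_le_msup hBddJ hj (i := (y, τ)) hb
    rw [hw3] at h
    have h' : ((L : ℝ) ^ j * η) ^ 3 * ‖Jcur η (1 : Site d → Fin d → ℂˣ) φ τ y‖ ≤ X := by rw [hX]; exact h
    linarith
  -- (ii): every averaging member on print's class is below `Y` (print's class lies in the index)
  have hii : ∀ j, j ≤ m → ∀ c ∈ cubeLamBP L a M ρ k m j,
      ‖linCovIter L (1 : Site d → Fin d → ℂˣ) (iEta η φ) j c.1 c.2‖ ≤ X + Y + Z := by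
    intro j hj c hc
    have h := le_wsup hQbd ⟨(j, c), hj, hI j hj c hc⟩
    rw [one_mul] at h
    have h' : ‖linCovIter L (1 : Site d → Fin d → ℂˣ) (iEta η φ) j c.1 c.2‖ ≤ Y := by rw [hY]; exact h
    linarith
  -- (iii): off the bonds of `□₀`, `η|φ|` is below the exterior-collar term `Z` (or `φ = 0`)
  have hiii : ∀ (y : Site d) (τ : Fin d), ¬ BondTouches (cubeFam false L a M ρ k 0) y τ → η * ‖φ y τ‖ ≤ X + Y + Z := by
    intro y τ hnb
    by_cases hs : SideTouches (cubeFam false L a M ρ k 0) y τ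
    · have h := weight_mul_norm_le_msup hBddZ (Nat.zero_le m) (i := (y, τ)) ⟨rfl, hs, hnb⟩
      rw [hw1, pow_zero, one_mul] at h
      have h' : η * ‖φ y τ‖ ≤ Z := by rw [hZ]; exact h
      linarith
    · have h0 : φ y τ = 0 := by
        refine hsupp y τ fun j _ hsj => hs ?_
        exact sideTouches_mono (cubeFam_subset_zero hL a M hρ k j) hsj
      rw [h0, norm_zero, mul_zero]
      positivity
  -- every bond is a side of a plaquette (`d ≥ 2`)
  haveI : Nontrivial (Fin d) := Fin.nontrivial_iff_two_le.mpr hd2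
  have hbs : ∀ (y : Site d) (τ : Fin d) (j : ℕ), BondTouches (cubeFam false L a M ρ k j) y τ →
      SideTouches (cubeFam false L a M ρ k j) y τ := fun y τ j hb => by
    obtain ⟨κ, hκ⟩ := exists_ne τ
    exact sideTouches_of_bondTouches hκ hb
  -- Step 3: the body at `N := X + Y + Z`
  have hN0 : 0 ≤ X + Y + Z := by positivity
  have hP := hbody φ hLan hsupp (X + Y + Z) hN0 hi hii hiii
  have hRHS : B₀ * (X + Y + Z) = B₀ * (X + Y) + B₀ * Z := by ring
  have hBN0 : 0 ≤ B₀ * (X + Y + Z) := by positivity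
  refine ⟨?_, ?_, ?_, ?_⟩
  · -- `|φ|₍₋₁₎`
    rw [← hRHS]
    refine msup_le hBN0 fun j hj b hb => ?_
    rw [hw1]
    exact (hP j hj b.1 b.2 hb).1
  · -- `|∇φ|₍₋₂₎`
    rw [← hRHS]
    refine msup_le hBN0 fun j hj t ht => ?_
    rw [hw2]
    exact (hP j hj t.2.2 t.2.1 ht).2.1 t.1
  · -- `|∂*∂φ|₍₋₃₎ = |J|₍₋₃₎ = X ≤ B₀(X + Y) + B₀Z` (`B₀ ≥ 1`)
    have h1 : X ≤ B₀ * X := le_mul_of_one_le_left hX0 hB₀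
    nlinarith [h1, hY0, hZ0, hB₀0]
  · -- `|Δφ|₍₋₃₎`
    rw [← hRHS]
    refine msup_le hBN0 fun j hj b hb => ?_
    rw [hw3]
    exact (hP j hj b.1 b.2 (hbs b.1 b.2 j hb)).2.2

#print axioms sc4_of_pointwise159

/-! ## §2 The UNIFORM clause on print's big-block sub-lattice, from dag-n05-c's named fact -/

/-- ★ **THE SCALAR FOUR-LINE (1.59) CLAUSE AT `U₀ = 1`, UNIFORMLY ON PRINT's p. 98 BIG-BLOCK SUB-LATTICE, FROM THE NAMED FACT
`Ineq159FlatCubeMemberPrinted d L`** ([4] Thm 3.3 at `U = 1` on the Dirichlet cube over print's class — HYPOTHESIS): one constant `B₀ ≥ 1` and thresholds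
`ρ₀, M₀, N₀, R₀` such that at every cube datum `(a, M, ρ, k, s, R)` of the sub-lattice (`M_h = Lˢ`: `M₀ ≤ L^{s+1}`, `L^{s+1} ∣ ρ`, `L^{s+1} ∣ M`, `R·L^{s+1} ≤ ρ`,
`R₀ ≤ R`, `N₀ + 1 ≤ R·L^{s+1}`, `ρ₀ ≤ ρ`; also `L ≤ ρ`, `k ≥ 1`), every truncation `1 ≤ m ≤ k`, every index predicate `I ⊇ cubeLamBP … m` and every `φ` in the
flat Landau gauge with the support clause, the four-line clause of §1 holds with `B_∂ := B₀`.  §1 applied to the named fact's body (constant enlarged to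
`max B₀ 1`).  CONDITIONAL on the named fact (taken as `h159`).
[cite: Balaban1985RegularSpaces, (1.59) p.86, (1.62) p.87, (1.31) p.82, (1.131)–(1.132) p.99, p.98; Balaban1985BackgroundPropagators, Thm 3.3 p.399; Balaban1984PropagatorsII, Prop. 2.6 (2.136) p.247, (2.3) p.224] -/
theorem sc4_cubeMember_of_ineq159Printed (hd2 : 2 ≤ d) {L : ℕ} (hL : 1 ≤ L) (h159 : Ineq159FlatCubeMemberPrinted d L) :
    ∃ B₀ ρ₀ M₀ : ℝ, ∃ N₀ R₀ : ℕ, 1 ≤ B₀ ∧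
    ∀ (η : ℝ), 0 < η → ∀ (a : Site d) (M ρ k s R : ℕ), 1 ≤ k → L ≤ ρ →
      M₀ ≤ (L : ℝ) ^ (s + 1) → L ^ (s + 1) ∣ ρ → L ^ (s + 1) ∣ M → R * L ^ (s + 1) ≤ ρ → R₀ ≤ R →
      N₀ + 1 ≤ R * L ^ (s + 1) → ρ₀ ≤ (ρ : ℝ) →
      ∀ m, 1 ≤ m → m ≤ k → ∀ (I : ℕ → Site d × Fin d → Prop), (∀ j, j ≤ m → ∀ c ∈ cubeLamBP L a M ρ k m j, I j c) →
      ∀ φ : Site d → Fin d → ℂ,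
        IsLandau138 L m η (cubeFam false L a M ρ k 0) (cubeLamS L a M ρ k m) (1 : Site d → Fin d → ℂˣ) φ →
        (∀ (y : Site d) (τ : Fin d), (∀ j, j ≤ m → ¬ SideTouches (cubeFam false L a M ρ k j) y τ) → φ y τ = 0) →
        msup L m η (-(1 : ℝ)) (fun j (b : Site d × Fin d) => SideTouches (cubeFam false L a M ρ k j) b.1 b.2) (fun b => φ b.1 b.2)
            ≤ B₀ * (bondNorm L m η (-(3 : ℝ)) (cubeFam false L a M ρ k) (fun x μ => Jcur η (1 : Site d → Fin d → ℂˣ) φ μ x)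
              + wsup 1 (fun p : {p : ℕ × (Site d × Fin d) // p.1 ≤ m ∧ I p.1 p.2} =>
                  linCovIter L (1 : Site d → Fin d → ℂˣ) (iEta η φ) p.1.1 p.1.2.1 p.1.2.2))
              + B₀ * msup L m η (-(1 : ℝ)) (fun j (b : Site d × Fin d) => j = 0 ∧ SideTouches (cubeFam false L a M ρ k 0) b.1 b.2 ∧
                  ¬ BondTouches (cubeFam false L a M ρ k 0) b.1 b.2) (fun b => φ b.1 b.2) ∧
          msup L m η (-(2 : ℝ)) (fun j (t : Fin d × Fin d × Site d) => SideTouches (cubeFam false L a M ρ k j) t.2.2 t.2.1)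
              (fun t => covDerivFwd η (1 : Site d → Fin d → ℂˣ) t.1 (fun z => φ z t.2.1) t.2.2)
            ≤ B₀ * (bondNorm L m η (-(3 : ℝ)) (cubeFam false L a M ρ k) (fun x μ => Jcur η (1 : Site d → Fin d → ℂˣ) φ μ x)
              + wsup 1 (fun p : {p : ℕ × (Site d × Fin d) // p.1 ≤ m ∧ I p.1 p.2} =>
                  linCovIter L (1 : Site d → Fin d → ℂˣ) (iEta η φ) p.1.1 p.1.2.1 p.1.2.2))
              + B₀ * msup L m η (-(1 : ℝ)) (fun j (b : Site d × Fin d) => j = 0 ∧ SideTouches (cubeFam false L a M ρ k 0) b.1 b.2 ∧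
                  ¬ BondTouches (cubeFam false L a M ρ k 0) b.1 b.2) (fun b => φ b.1 b.2) ∧
          bondNorm L m η (-(3 : ℝ)) (cubeFam false L a M ρ k)
              (fun x μ => pdiv η (1 : Site d → Fin d → ℂˣ) (plaqCovDeriv η (1 : Site d → Fin d → ℂˣ) φ) μ x)
            ≤ B₀ * (bondNorm L m η (-(3 : ℝ)) (cubeFam false L a M ρ k) (fun x μ => Jcur η (1 : Site d → Fin d → ℂˣ) φ μ x)
              + wsup 1 (fun p : {p : ℕ × (Site d × Fin d) // p.1 ≤ m ∧ I p.1 p.2} =>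
                  linCovIter L (1 : Site d → Fin d → ℂˣ) (iEta η φ) p.1.1 p.1.2.1 p.1.2.2))
              + B₀ * msup L m η (-(1 : ℝ)) (fun j (b : Site d × Fin d) => j = 0 ∧ SideTouches (cubeFam false L a M ρ k 0) b.1 b.2 ∧
                  ¬ BondTouches (cubeFam false L a M ρ k 0) b.1 b.2) (fun b => φ b.1 b.2) ∧
          bondNorm L m η (-(3 : ℝ)) (cubeFam false L a M ρ k) (fun x μ => covLap η (1 : Site d → Fin d → ℂˣ) (fun z => φ z μ) x)
            ≤ B₀ * (bondNorm L m η (-(3 : ℝ)) (cubeFam false L a M ρ k) (fun x μ => Jcur η (1 : Site d → Fin d → ℂˣ) φ μ x)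
              + wsup 1 (fun p : {p : ℕ × (Site d × Fin d) // p.1 ≤ m ∧ I p.1 p.2} =>
                  linCovIter L (1 : Site d → Fin d → ℂˣ) (iEta η φ) p.1.1 p.1.2.1 p.1.2.2))
              + B₀ * msup L m η (-(1 : ℝ)) (fun j (b : Site d × Fin d) => j = 0 ∧ SideTouches (cubeFam false L a M ρ k 0) b.1 b.2 ∧
                  ¬ BondTouches (cubeFam false L a M ρ k 0) b.1 b.2) (fun b => φ b.1 b.2) := by
  obtain ⟨B₀, ρ₀, M₀, N₀, R₀, hB₀, H⟩ := h159
  refine ⟨max B₀ 1, ρ₀, M₀, N₀, R₀, le_max_right _ _, ?_⟩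
  intro η hη a M ρ k s R hk hρL hM₀ hdρ hdM hR hR₀ hN₀ hρ₀ m hm1 hmk I hI φ hLan hsupp
  refine sc4_of_pointwise159 hd2 hL hη a M hρL hmk (le_max_right _ _) I hI (fun ψ hψ hψ0 N hN h1 h2 h3 j hj y τ hs => ?_) φ hLan hsupp
  obtain ⟨q1, q2, q3⟩ := H η hη a M ρ k s R hk hM₀ hdρ hdM hR hR₀ hN₀ hρ₀ m hm1 hmk ψ hψ hψ0 N hN h1 h2 h3 j hj y τ hs
  have hmono : B₀ * N ≤ max B₀ 1 * N := mul_le_mul_of_nonneg_right (le_max_left _ _) hN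
  exact ⟨q1.trans hmono, fun ν => (q2 ν).trans hmono, q3.trans hmono⟩

#print axioms sc4_cubeMember_of_ineq159Printed

/-! ## §3 The PER-CUBE inhabitant: at every fixed cube datum the clause holds with SOME `B₀` (dag-n05-w3's kernel theorem) -/

/-- ★ **THE FLAT LINE's SCALAR (1.59) CLAUSE IS INHABITED AT EVERY CUBE DATUM** (A6 witness, `B₀` depending on the cube): for every `η > 0`, cube datum
`(a, M, ρ, k)` with `L ≤ ρ`, truncation `1 ≤ m ≤ k` and index predicate `I ⊇ cubeLamBP … m`, there is `B₀ ≥ 1` such that the four-line clause of §1 holds for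
every `φ` in the flat Landau gauge with the support clause.  §1 applied to dag-n05-w3's `B8Ineq159FlatCubeMemberPerCube.exists_B0_ineq159Flat_perCube`
(finite-dimensional kernel argument at fixed `η`: the crossing datum of print's class kills the shell gauge modes).  UNCONDITIONAL; the constant is NOT uniform in
the cube — the uniform one is §2's hypothesis.
[cite: Balaban1985RegularSpaces, (1.59) p.86, (1.62) p.87, (1.31) p.82, (1.131) p.99; Balaban1984PropagatorsII, (2.3) p.224] -/
theorem sc4_cubeMember_inhabited (hd2 : 2 ≤ d) {L : ℕ} (hL : 1 ≤ L) {η : ℝ} (hη : 0 < η) (a : Site d) (M : ℕ) {ρ : ℕ} (hρL : L ≤ ρ)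
    {k m : ℕ} (hm1 : 1 ≤ m) (hmk : m ≤ k) (I : ℕ → Site d × Fin d → Prop) (hI : ∀ j, j ≤ m → ∀ c ∈ cubeLamBP L a M ρ k m j, I j c) :
    ∃ B₀ : ℝ, 1 ≤ B₀ ∧ ∀ φ : Site d → Fin d → ℂ,
        IsLandau138 L m η (cubeFam false L a M ρ k 0) (cubeLamS L a M ρ k m) (1 : Site d → Fin d → ℂˣ) φ →
        (∀ (y : Site d) (τ : Fin d), (∀ j, j ≤ m → ¬ SideTouches (cubeFam false L a M ρ k j) y τ) → φ y τ = 0) →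
        msup L m η (-(1 : ℝ)) (fun j (b : Site d × Fin d) => SideTouches (cubeFam false L a M ρ k j) b.1 b.2) (fun b => φ b.1 b.2)
            ≤ B₀ * (bondNorm L m η (-(3 : ℝ)) (cubeFam false L a M ρ k) (fun x μ => Jcur η (1 : Site d → Fin d → ℂˣ) φ μ x)
              + wsup 1 (fun p : {p : ℕ × (Site d × Fin d) // p.1 ≤ m ∧ I p.1 p.2} =>
                  linCovIter L (1 : Site d → Fin d → ℂˣ) (iEta η φ) p.1.1 p.1.2.1 p.1.2.2))
              + B₀ * msup L m η (-(1 : ℝ)) (fun j (b : Site d × Fin d) => j = 0 ∧ SideTouches (cubeFam false L a M ρ k 0) b.1 b.2 ∧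
                  ¬ BondTouches (cubeFam false L a M ρ k 0) b.1 b.2) (fun b => φ b.1 b.2) ∧
          msup L m η (-(2 : ℝ)) (fun j (t : Fin d × Fin d × Site d) => SideTouches (cubeFam false L a M ρ k j) t.2.2 t.2.1)
              (fun t => covDerivFwd η (1 : Site d → Fin d → ℂˣ) t.1 (fun z => φ z t.2.1) t.2.2)
            ≤ B₀ * (bondNorm L m η (-(3 : ℝ)) (cubeFam false L a M ρ k) (fun x μ => Jcur η (1 : Site d → Fin d → ℂˣ) φ μ x)
              + wsup 1 (fun p : {p : ℕ × (Site d × Fin d) // p.1 ≤ m ∧ I p.1 p.2} =>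
                  linCovIter L (1 : Site d → Fin d → ℂˣ) (iEta η φ) p.1.1 p.1.2.1 p.1.2.2))
              + B₀ * msup L m η (-(1 : ℝ)) (fun j (b : Site d × Fin d) => j = 0 ∧ SideTouches (cubeFam false L a M ρ k 0) b.1 b.2 ∧
                  ¬ BondTouches (cubeFam false L a M ρ k 0) b.1 b.2) (fun b => φ b.1 b.2) ∧
          bondNorm L m η (-(3 : ℝ)) (cubeFam false L a M ρ k)
              (fun x μ => pdiv η (1 : Site d → Fin d → ℂˣ) (plaqCovDeriv η (1 : Site d → Fin d → ℂˣ) φ) μ x)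
            ≤ B₀ * (bondNorm L m η (-(3 : ℝ)) (cubeFam false L a M ρ k) (fun x μ => Jcur η (1 : Site d → Fin d → ℂˣ) φ μ x)
              + wsup 1 (fun p : {p : ℕ × (Site d × Fin d) // p.1 ≤ m ∧ I p.1 p.2} =>
                  linCovIter L (1 : Site d → Fin d → ℂˣ) (iEta η φ) p.1.1 p.1.2.1 p.1.2.2))
              + B₀ * msup L m η (-(1 : ℝ)) (fun j (b : Site d × Fin d) => j = 0 ∧ SideTouches (cubeFam false L a M ρ k 0) b.1 b.2 ∧
                  ¬ BondTouches (cubeFam false L a M ρ k 0) b.1 b.2) (fun b => φ b.1 b.2) ∧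
          bondNorm L m η (-(3 : ℝ)) (cubeFam false L a M ρ k) (fun x μ => covLap η (1 : Site d → Fin d → ℂˣ) (fun z => φ z μ) x)
            ≤ B₀ * (bondNorm L m η (-(3 : ℝ)) (cubeFam false L a M ρ k) (fun x μ => Jcur η (1 : Site d → Fin d → ℂˣ) φ μ x)
              + wsup 1 (fun p : {p : ℕ × (Site d × Fin d) // p.1 ≤ m ∧ I p.1 p.2} =>
                  linCovIter L (1 : Site d → Fin d → ℂˣ) (iEta η φ) p.1.1 p.1.2.1 p.1.2.2))
              + B₀ * msup L m η (-(1 : ℝ)) (fun j (b : Site d × Fin d) => j = 0 ∧ SideTouches (cubeFam false L a M ρ k 0) b.1 b.2 ∧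
                  ¬ BondTouches (cubeFam false L a M ρ k 0) b.1 b.2) (fun b => φ b.1 b.2) := by
  obtain ⟨B₀, hB₀, H⟩ := exists_B0_ineq159Flat_perCube hd2 hL hη a M ρ hm1 hmk
  refine ⟨max B₀ 1, le_max_right _ _, fun φ hLan hsupp => ?_⟩
  refine sc4_of_pointwise159 hd2 hL hη a M hρL hmk (le_max_right _ _) I hI (fun ψ hψ hψ0 N hN h1 h2 h3 j hj y τ hs => ?_) φ hLan hsupp
  obtain ⟨q1, q2, q3⟩ := H ψ hψ hψ0 N hN h1 h2 h3 j hj y τ hs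
  have hmono : B₀ * N ≤ max B₀ 1 * N := mul_le_mul_of_nonneg_right (le_max_left _ _) hN
  exact ⟨q1.trans hmono, fun ν => (q2 ν).trans hmono, q3.trans hmono⟩

#print axioms sc4_cubeMember_inhabited

/-- **The flat line's split index contains print's class**: with `I j c := c ∈ cubeLamBP' … m j ∨ (j = 0 ∧ CrossB □₀ c)` (dag-n06-b's split class +
the socket's own crossing disjunct), `cubeLamBP … m j ⊆ I j` for all `j ≤ m` (`1 ≤ L`, `1 ≤ ρ`, `1 ≤ m ≤ k`): at `j = 0` by dag-n05-w3's dictionary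
`B8Ineq159FlatCubeMemberPerCubeGamma.mem_cubeLamBP_zero_iff_cubeLamBP'_or_crossB` (p588005), at `j ≥ 1` the two classes coincide (`cubeLamBP'_of_ne_zero`).
[cite: Balaban1985RegularSpaces, (1.31) p.82, p.77; Balaban1984PropagatorsII, (2.3) p.224] -/
theorem cubeLamBP_sub_splitIndex {L : ℕ} (hL : 1 ≤ L) (a : Site d) (M : ℕ) {ρ : ℕ} (hρ : 1 ≤ ρ) {k m : ℕ} (hm1 : 1 ≤ m) (hmk : m ≤ k) :
    ∀ j, j ≤ m → ∀ c ∈ cubeLamBP L a M ρ k m j, (c ∈ cubeLamBP' L a M ρ k m j ∨ (j = 0 ∧ CrossB (cubeFam false L a M ρ k 0) c)) := by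
  intro j _ c hc
  rcases Nat.eq_zero_or_pos j with rfl | hj
  · rcases (mem_cubeLamBP_zero_iff_cubeLamBP'_or_crossB hL a M hρ hm1 hmk c).1 hc with h | h
    · exact Or.inl h
    · exact Or.inr ⟨rfl, h⟩
  · exact Or.inl (by rw [cubeLamBP'_of_ne_zero L a M ρ k m (Nat.pos_iff_ne_zero.mp hj)]; exact hc)

#print axioms cubeLamBP_sub_splitIndex

end Literature.MathematicalPhysics.QuantumFieldTheory.Balaban1983to89.B8Ineq159FlatCubeMemberSCGamma

end
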